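import Literature.MathematicalPhysics.QuantumFieldTheory.Balaban1983to89.B9Cor36GDirKnitGVDivFormAtCutField

/-!
# `Balaban1983to89.B9Cor36GDirKnitRightEntryAtCutField` — [Balaban1985BackgroundPropagators] COROLLARY 3.6 p. 408 FOR THE DIRICHLET BOND LETTER OF RECORD
# `G_□(U) = GDirCKY i □ (DP_□D*) (bondsOverY Ω₀(□)) U` (p. 409 l. 1–5) AT THE SHARP-CUT SMALL FIELD `Ṽ = cutCfgS i T η A`: THE FLAT HALF OF THE RIGHT ENTRY
# (3.42)₃ — `G_□(Ṽ)·∇*_{1,ν} ≺ B₂·Lⁿη·e^{−ρd}` — EXACTLY THE DISPLAYED HYPOTHESIS `hR` of F5 ✓`gDir_knit_entries_at_cutFieldU` ∕ F6 ✓`cubeRowsGDirCY_at_memberU` and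
# the heads' `hRflA` (cell GAPS G-B9-02), PROVED modulo the named printed fact [4] Prop. 2.6 for `G(Ω)` read with its third entry (`h26R`): (3.86) in the LEFT
# resolvent form `G(Ṽ) = G(1) + G(1)V G(Ṽ)` (F4, compressed here) times `∇*_ν`, r06's fixed point ✓`gExt_rightEntry_of_386L` closed by [4] Lemma 2.1 and the
# p. 398 convention, with Theorem 3.3's right entry at `U = 1` (R1) and the left composite `G(1)·V` (R3) — the Dirichlet twin of p33's
# ✓`cor36_G_cube_rightEntry_at_locCfg` (seat dag-n06-c g36, FILE R4 = layer L-ASM of «E2 BY NAME»)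

statement-level skeleton of published theorems with citation tags; proofs where landed; nothing here is a claim about the Yang–Mills mass gap

CITATION HEADER (lean-in-tree rule).  B9 = T. Bałaban, *Propagators for lattice gauge theories in a background field*, Commun. Math. Phys. **99** (1985)
389–434 [Balaban1985BackgroundPropagators] (held `paper:balaban1985-cmp99-background-propagators`; journal page = PDF page + 388): p. 407 (3.86) («G(U′U) = G(U)(I −
V(A)G(U))⁻¹ = Σ_{n=0}^∞ G(U)(V(A)G(U))ⁿ … Theorem (3.3) implies also convergence in all norms appearing in its formulation, thus in all norms on the left-hand sides
of the inequalities (3.42)–(3.47). This way we get all these inequalities for the operator G(U′U)»); p. 397 (3.42), third entry («|(G′(U)∇*_Uλ)(x)| ≦ B₀Lʲη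
e^{−δ₀d(y,y′)}|λ|»); p. 399 Thm 3.3; Cor. 3.6 p. 408 l. 7–14; p. 398 l. 20–24 (the convention); Cor. 3.5 p. 407; p. 409 l. 1–5 («G_□(U)»).  [4] =
[Balaban1984PropagatorsII] Prop. 2.6 (2.136)₃ p. 247, p. 248 l. 4–5, Lemma 2.1 (2.61)∕(2.66) p. 234, (2.51) p. 232.  Rows B9.Cor3.6 × B9.Eq3.86 × B9.Eq3.42 × B6.Prop2.6
(cells only; no row head changes).

WHY THIS FILE (cell `pub-ymgap`, node N06 [B9]; road (B5)).  dag-n06-d's heads of record «KE₂₁X-C» ✓p836416 ∕ «KESC-CO» ✓p836424 display, for the bond letter of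
record, the flat right half `hRflA : G_□(Ṽ)·conj(∇*_{1,ν}) ≺ BA₂·Lⁿη·e^{−δd}` at the cut fields of the data (F5's E2 clause reduces the covariant right entry
`G_□(Ṽ)·∇*_{Ṽ,ν}` to it; F6 carries it as `hR`; this seat's LOCATED-36∕38).  THIS FILE proves it — under F4's binder list VERBATIM with `h26 ↦ h26R` — so that the
heads can key ONE named fact `h26R : B6.Prop26DirichletPrinted geoDirBI domDirBI admDirBI GDirBFamR` (R1 ✓`prop26Dirichlet_of_right` gives back `h26`) and drop
`hRflA` (R5 re-presses F6's bundle without `hR`).  §1 `GiK_leftLaw_of_padded`: F4's padded law 1 `GdK(Ṽ) = GdK(1) + GdK(1)·V·GdK(Ṽ)` compressed by `𝟙♯` to the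
interior letter, `GiK(Ṽ) = GiK(1) + GiK(1)·V·GiK(Ṽ)` (r06's `h386L`); §2 ★★★`gDir_knit_rightFlat_at_cutFieldU`.

WHAT IS PROVED (0 `def`s; theorems; 0 sorry; 0 new named facts; standard axioms): §1 `GiK_leftLaw_of_padded`; §2 ★★★`gDir_knit_rightFlat_at_cutFieldU`: there are `ρ_R > 0`,
`B₂ ≥ 0`, thresholds `M_R, T_R, N_R`, `a_R > 0` such that for every member above the thresholds, every auxiliary `α₀`, every cover cube, `Rr, H`, bond socket `K_B`, cut set
`T ⊇ Ω₀(□)` and datum `(A; Q, C, ξ, Λ)` with F4's displayed numerics (`2CΛ² ≤ a_R`, …) and bi-contractive `Ṽ`, and every direction `ν`: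
`GiK b i (TKnitCY i □ Ṽ) B · conj b(cdsBₗ i 1 ν) ≺ B₂·(geoCK i □).len a·e^{−ρ_R d(a,a′)}` over `(toB6 (geoCK i □) Rr H, blkBK i □)`.

HONEST SCOPE ∕ NOT CLAIMED.  Assembly over landed modules (F4, R1, R3, r06 §2, ✓`exists_h261_geoCK`, ✓`hST_geoCK`); CONDITIONAL BY NAME on [4] Prop. 2.6 for `G(Ω)` read
with its third entry (`h26R`); DISPLAYED exactly as in F4: the bond socket `hKB` (✓`exists_bondSocket` inhabits it), the cut set and (3.35) datum (LOCATED-32), the x-free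
numerics of the knit engine, `hU`, member thresholds.  The COVARIANT right entry `G_□(Ṽ)·∇*_{Ṽ,ν}` is F5's E2 clause fed with this file; the member-level bundle is R5.
Nothing on `d = 4`, the continuum, reflection positivity or the mass gap; NOT a node discharge; count-neutral; no row head changes.  NEW file; nothing landed is modified.
`--supports stmt-QuantumFields-27239`.

RELATED IN THE TREE, NOT DUPLICATED (searched 2026-08-31: `rg 'gDir_knit_rightFlat|GiK_leftLaw_of_padded'` over `Literature/` + `Summits/` = ∅): p33 ✓`B9Cor36GCubeRightEntryAtLocCfg`
(the torus twin; `conj_cdsBₗ_one` USED), r06 ✓`B9Ineq386RightEntry` (engine; USED), F4 ✓`B9Cor36GDirKnitAtCutField` (unit, laws; USED), R1 ✓`B9Prop26DirichletBondReadingRight`,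
R3 ✓`B9Cor36GDirKnitGVDivFormAtCutField` (USED), F5∕F6 (the consumers of this file's conclusion).
-/

noncomputable section

namespace Literature.MathematicalPhysics.QuantumFieldTheory.Balaban1983to89.B9Cor36GDirKnitRightEntryAtCutField

open NormedSpace Complex
open B6RandomWalk (HasMajorant hasMajorant_mono Ineq261 c1_nonneg)
open B9Thm34Ext (toB6)
open B9Eq352DivFormLetters (conj)
open B9Eq39Adjoint (covD)
open B6KLevelCensusIndexV1 (KIdx kGeo)
open B6Cover236MultiLevelBlocks (cubes)
open B6GlobalChartV1 (PV boxEquiv)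
open B9BackgroundsKLevelV1 (shiftsV1)
open B9Eq360DeltaPrimeAY (AfldY)
open B9Eq337CutFieldDirY (cutCfgS)
open B9CubeLettersOpsL0 (levCubeY)
open B9CubeLettersBondOpsL0 (BlkCubeY)
open B9CubeGeometryInputs (geoCK geoCK_len_pos geoCK_dist_axioms RM1 N1 exists_h261_geoCK hST_geoCK)
open B9Cor35GCubeInputsAtOne (blkBK)
open B9Cor35GDirInputsAtOne (GiK GdK mDirC geoDirBI domDirBI admDirBI)
open B9Cor35GDirGStep (VdK projK GiK_eq_proj_GdK_proj projK_mul_VdK VdK_mul_projK)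
open B9Cor35GDirKnitInputsAtOne (TKnitCY)
open B9Cor36GDirKnitAtCutField (gDir_knit_at_cutFieldU)
open B9Cor35CinvAtCubeLetters (kernel_rate_mono)
open B9Cor35GpDirInputsAtOne (dirDomY)
open B9C2FormBoxRegimeY (Kpl)
open B7Prop5CplxLevels (epsCplx tauCplx)
open B7Prop2Explicit (C0 c2')
open B7Prop3Flat (c3)
open B9Prop26DirichletBondReadingRight (GDirBFamR prop26Dirichlet_of_right thm33_GiK_knit_right_of_prop26DirichletR)
open B9Cor36GDirKnitGVDivFormAtCutField (gDir_knit_GiK_mul_VdK_at_cutFieldU)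
open B9Thm33CubeAtOneRight (DsK)
open B9Ineq386RightEntry (gExt_rightEntry_of_386L)
open B9Cor36GCubeRightEntryAtLocCfg (conj_cdsBₗ_one)
open B9CoReadingCoords (cdsBₗ)
open Node00 (SiteY FBondY CfgY toKT shiftY)
open Node00.OpsYCubeDirInverseBond (bondsOverY)
open scoped Matrix Matrix.Norms.L2Operator

variable {d ℓ : ℕ} {hd : 1 ≤ d + 1} {hL : Odd (ℓ + 1) ∧ 1 < ℓ + 1} {b₀ b₁ : ℝ}

/-! ## §1  The compressed LEFT resolvent law of (3.86) for the interior letter -/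

section Law

variable {𝔸 : Type} [NormedRing 𝔸] [NormedAlgebra ℂ 𝔸] [CompleteSpace 𝔸]
variable {ι : Type} [Fintype ι] (b : Module.Basis ι ℝ 𝔸)
variable (i : KIdx d ℓ hd hL b₀ b₁)
variable {T : CfgY 𝔸 i → ((FBondY i → 𝔸) →ₗ[ℂ] (FBondY i → 𝔸))} {B : Finset (FBondY i)}

/-- ★ **(3.86), LEFT RESOLVENT FORM, COMPRESSED**: from the padded law `G(Ṽ) = G(1) + G(1)·V·G(Ṽ)` (F4 ∕ ✓`gStep_dirB`, law 1) multiply by `𝟙♯` on both sides and use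
`V = 𝟙♯V = V𝟙♯`: `GiK(Ṽ) = GiK(1) + GiK(1)·V·GiK(Ṽ)` — r06's `h386L` at the interior Dirichlet bond letter (the mirror of ✓`gStep_dirB`'s compressed right law).
[cite: Balaban1985BackgroundPropagators, (3.86) p.407, p.394 («Ω₀G′ = G′»), Cor. 3.5 p.407, p.409 l.3–5] -/
theorem GiK_leftLaw_of_padded (V : CfgY 𝔸 i)
    (hlaw : GdK b i (T V) B = GdK b i (T (fun _ _ => 1)) B + GdK b i (T (fun _ _ => 1)) B * VdK b i T B V * GdK b i (T V) B) :
    GiK b i (T V) B = GiK b i (T (fun _ _ => 1)) B + GiK b i (T (fun _ _ => 1)) B * VdK b i T B V * GiK b i (T V) B := by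
  have hPVP : VdK b i T B V = projK b i B * VdK b i T B V * projK b i B := by rw [projK_mul_VdK, VdK_mul_projK]
  rw [GiK_eq_proj_GdK_proj b i B (T V), GiK_eq_proj_GdK_proj b i B (T (fun _ _ => 1))]
  conv_lhs => rw [hlaw]
  rw [mul_add, add_mul]
  congr 1
  conv_lhs => rw [hPVP]
  simp only [mul_assoc]

end Law

/-! ## §2  ★★★ The flat half of the right entry (3.42)₃ at the Dirichlet bond letter of record and the sharp-cut field -/

section Main

variable {N : ℕ} [Nonempty (Fin N)]
variable {ι : Type} [Fintype ι] [DecidableEq ι] (b : Module.Basis ι ℝ (Matrix (Fin N) (Fin N) ℂ))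

set_option maxHeartbeats 4000000 in
/-- ★★★ **COROLLARY 3.6 FOR THE DIRICHLET BOND LETTER OF RECORD, THE FLAT HALF OF THE RIGHT ENTRY (3.42)₃: `G_□(Ṽ)·∇*_{1,ν} ≺ B₂·Lⁿη·e^{−ρ_R d}` AT THE SHARP-CUT
FIELD, UNIFORMLY IN THE MEMBER, THE AUXILIARY `α₀` AND THE COVER CUBE — CONDITIONAL BY NAME ON [4] PROP. 2.6 FOR `G(Ω)` READ WITH ITS THIRD ENTRY** (F4's
✓`gDir_knit_at_cutFieldU` binder list VERBATIM; conclusion = F5's ∕ F6's displayed `hR` and the heads' `hRflA`).  PROOF = print's: (3.86) in the left resolvent form times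
`∇*_ν`, the fixed point closed by [4] Lemma 2.1 at `(ρ₀, 9∕5000)` and the p. 398 convention (r06 ✓`gExt_rightEntry_of_386L`), with Theorem 3.3's right entry for
`G_□(1)` (R1, `h26R`) and the left composite `G_□(1)·V_□(Ṽ)` (R3), both rate-weakened to `ρ₀ = min(ρ_D, δ₃)`; smallness `κ_D·(2CΛ²)·c₁ ≤ 1∕2` from `2CΛ² ≤ a_R`.
[cite: Balaban1985BackgroundPropagators, Cor. 3.6 p.408, Thm 3.4 p.400, (3.84)–(3.86) p.407, Thm 3.3 p.399, (3.42) p.397 (third entry), p.398 l.20–24, Cor. 3.5 p.407, p.409 l.1–5; Balaban1984PropagatorsII, Prop. 2.6 (2.136) p.247, p.248 l.4–5, Lemma 2.1 (2.61) p.234, (2.66) p.234, (2.51) p.232] -/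
theorem gDir_knit_rightFlat_at_cutFieldU
    (h26R : B6.Prop26DirichletPrinted (geoDirBI (d := d) (ℓ := ℓ) (hd := hd) (hL := hL) (b₀ := b₀) (b₁ := b₁)) domDirBI admDirBI GDirBFamR)
    (hℓ : 1 ≤ ℓ) (hb₀ : 0 < b₀) (hb₁ : b₀ ≤ b₁) (M₂ : ℝ) (hM₂ : 0 ≤ M₂) (hrepr : ∀ (v : Matrix (Fin N) (Fin N) ℂ) (j : ι), |b.repr v j| ≤ M₂ * ‖v‖)
    {α₀' ϱ' ϱ : ℝ} (hα' : 0 < α₀') (hα3 : C0 (d + 1) * α₀' ≤ 1 / 3) (hα8 : 8 * α₀' ≤ c2' (d + 1) (ℓ + 1))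
    (hϱ' : 0 < ϱ') (hϱ : 0 < ϱ)
    (hsmall' : Real.exp (4 * (800 * (((d + 1 : ℕ) : ℝ) + 1) ^ 2 * (((d + 1 : ℕ) : ℝ) + 4)) * α₀') * (1 + 8 * (131072 * (((d + 1 : ℕ) : ℝ) + 1) ^ 2) * ϱ') ≤ 2)
    (hc₃' : 2 * ϱ' ≤ c3 (d + 1) (ℓ + 1)) (hϱ'1 : 409600 * (((d + 1 : ℕ) : ℝ) + 1) ^ 2 * ϱ' ≤ 1)
    (hE : epsCplx (d + 1) (ℓ + 1) ϱ' 0 ≤ 1 / 16)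
    (hdX : ((d + 1 : ℕ) : ℝ) * (epsCplx (d + 1) (ℓ + 1) ϱ' 0 + tauCplx (d + 1) (ℓ + 1) α₀' 0 ϱ' 0) ≤ 1 / 16)
    (hsmallJ : Real.exp (4480 * (((d + 1 : ℕ) : ℝ) + 1) ^ 2 * (((d + 1 : ℕ) : ℝ) + 4) * α₀' + 240000 * (((d + 1 : ℕ) : ℝ) + 1) ^ 3 * ϱ') *
      (1 + 8 * (2097152 * (((d + 1 : ℕ) : ℝ) + 1) ^ 2) * ϱ) ≤ 2)
    (hc₃J : 2 * ϱ ≤ c3 (d + 1) (ℓ + 1) / 4) :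
    ∃ ρR B₂ MR TR : ℝ, ∃ NR : ℕ, 0 < ρR ∧ 0 ≤ B₂ ∧ ∃ aR : ℝ, 0 < aR ∧
    ∀ (i : KIdx d ℓ hd hL b₀ b₁) (c : ↥(cubes (toKT i).D.toDomains)) (Rr : ℝ) (H : Prop),
      MR ≤ ((ℓ : ℝ) + 1) * (toKT i).Mh → NR + 1 ≤ (toKT i).R * ((ℓ + 1) * (toKT i).Mh) → TR ≤ RM1 i →
    ∀ α₀ : ℝ, 0 < α₀ → 0 ≤ (kGeo i).M * α₀ → Kpl i ((kGeo i).M * α₀) * (kGeo i).L ^ 4 < α₀' →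
    ∀ (KB : Matrix (FBondY i) (FBondY i) ℝ),
      (mDirC i c).submatrix (fun v : ↥(bondsOverY i (dirDomY i c)) => (v : FBondY i)) (fun v : ↥(bondsOverY i (dirDomY i c)) => (v : FBondY i)) *
        KB.submatrix (fun v : ↥(bondsOverY i (dirDomY i c)) => (v : FBondY i)) (fun v : ↥(bondsOverY i (dirDomY i c)) => (v : FBondY i)) = 1 →
    ∀ (T : Finset (SiteY i)) (A : AfldY (Matrix (Fin N) (Fin N) ℂ) i) (Q : Set (Site (PV d ℓ i.m i.K hd hL) 0)) (C ξ Λ : ℝ),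
      0 ≤ C → (kGeo i).eta ≤ ξ → 1 ≤ Λ → LatticeNorms.scaleLen ((ℓ : ℝ) + 1) (kGeo i).eta (c.1.1 + 1) ≤ Λ * ξ →
      (∀ z ∈ dirDomY i c, z ∈ T) → (∀ z ∈ T, (boxEquiv i.hN).symm z ∈ Q) →
      (∀ κ, ∀ x ∈ Q, ‖A κ x‖ ≤ C * ξ⁻¹) →
      (∀ μ ν, ∀ x ∈ Q, ‖(((kGeo i).eta : ℂ)⁻¹) • covD (shiftsV1 (PV d ℓ i.m i.K hd hL)) (fun _ _ => (1 : (Matrix (Fin N) (Fin N) ℂ)ˣ)) μ (A ν) x‖ ≤ C * (ξ ^ 2)⁻¹) →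
      (∀ z : SiteY i, 1 ≤ levCubeY i c z → z ∈ dirDomY i c ∧ ∀ μ, shiftY i μ z ∈ dirDomY i c ∧ (shiftY i μ).symm z ∈ dirDomY i c ∧
        ∀ ν, shiftY i ν (shiftY i μ z) ∈ dirDomY i c ∧ shiftY i ν ((shiftY i μ).symm z) ∈ dirDomY i c ∧ (shiftY i ν).symm ((shiftY i μ).symm z) ∈ dirDomY i c) →
      2 * C * Λ ^ 2 ≤ aR → 3 * (2 * C * Λ ^ 2) ≤ ϱ' →
      4 * α₀' ≤ c2' (d + 1) (ℓ + 1) →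
      Real.exp (4 * (800 * (((d + 1 : ℕ) : ℝ) + 1) ^ 2 * (((d + 1 : ℕ) : ℝ) + 4)) * α₀') * (1 + 8 * (131072 * (((d + 1 : ℕ) : ℝ) + 1) ^ 2) * (2 * C * Λ ^ 2)) ≤ 2 →
      2 * (2 * C * Λ ^ 2) ≤ c3 (d + 1) (ℓ + 1) → 4096 * ((d + 1 : ℕ) : ℝ) * (2 * C * Λ ^ 2) ≤ 1 →
      (∀ μ x, ‖(cutCfgS i T (kGeo i).eta A μ x : Matrix (Fin N) (Fin N) ℂ)‖ ≤ 1 ∧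
        ‖(((cutCfgS i T (kGeo i).eta A μ x)⁻¹ : (Matrix (Fin N) (Fin N) ℂ)ˣ) : Matrix (Fin N) (Fin N) ℂ)‖ ≤ 1) →
      ∀ ν : Fin (d + 1), HasMajorant (g := toB6 (geoCK i c) Rr H) (blkBK i c)
        (GiK b i (TKnitCY i c (cutCfgS i T (kGeo i).eta A)) (bondsOverY i (dirDomY i c)) * conj b (cdsBₗ i (fun _ _ => (1 : (Matrix (Fin N) (Fin N) ℂ)ˣ)) ν))
        (fun a a' => B₂ * (geoCK i c).len a * Real.exp (-(ρR * (geoCK i c).dist a a'))) := by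
  classical
  -- F4 (at `h26 := prop26Dirichlet_of_right h26R`): the (3.86) laws — we use law 1, the LEFT resolvent form, compressed (§1)
  obtain ⟨ρ₄, θ₄, M₄, T₄, N₄, -, -, a₄, ha₄, AG, -, h4⟩ := gDir_knit_at_cutFieldU b (prop26Dirichlet_of_right h26R) hℓ hb₀ hb₁ M₂ hM₂ hrepr hα' hα3 hα8 hϱ' hϱ
    hsmall' hc₃' hϱ'1 hE hdX hsmallJ hc₃J
  -- R1: Theorem 3.3's right entry for `G_□(1)` (rate `δ₃`, constant `AR`)
  obtain ⟨M₁, δ₃, AR, hM₁, hδ₃, hAR, h33⟩ := thm33_GiK_knit_right_of_prop26DirichletR (N := N) b h26R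
  -- R3: the left composite `G_□(1)·V_□(Ṽ) ≺ κ_D·(2CΛ²)·e^{−ρ_D d}`
  obtain ⟨ρD, κD, MD, TD, ND, hρD, hκD, aD, haD, hD⟩ := gDir_knit_GiK_mul_VdK_at_cutFieldU b h26R hℓ hb₀ hb₁ M₂ hM₂ hrepr hα' hα3 hα8 hϱ' hϱ hsmall' hc₃' hϱ'1 hE
    hdX hsmallJ hc₃J
  -- the working rate
  set ρ₀ : ℝ := min ρD δ₃ with hρ₀def
  have hρ₀ : 0 < ρ₀ := lt_min hρD hδ₃
  have hρ₀D : ρ₀ ≤ ρD := min_le_left _ _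
  have hρ₀E : ρ₀ ≤ δ₃ := min_le_right _ _
  -- [4] (2.61) at `(ρ₀, 9∕5000)` on the cube sequence's geometry
  obtain ⟨dB, h261⟩ := exists_h261_geoCK d ℓ hρ₀
  set c₁ : ℝ := B6.c1 dB ρ₀ (9 / 5000) with hc₁def
  have hc₁ : 0 ≤ c₁ := c1_nonneg _ _ _
  -- the size threshold
  set aR : ℝ := min a₄ (min aD (1 / (2 * (κD * c₁ + 1)))) with haRdef
  have hκc : 0 < κD * c₁ + 1 := by positivity
  have haR : 0 < aR := lt_min ha₄ (lt_min haD (by positivity))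
  set Λ4 : ℝ := ((ℓ : ℝ) + 1) ^ 4 with hΛ4def
  have hΛ4 : 0 ≤ Λ4 := by positivity
  refine ⟨(1 - 3 * (9 / 5000)) * ρ₀, 2 * AR * Λ4 ^ 2 * c₁, max M₄ (max MD M₁), max T₄ (max TD (4 * Real.log ((ℓ : ℝ) + 1) / (9 / 5000 * ρ₀))),
    max N₄ (max ND (N1 d ℓ (9 / 5000 * ρ₀))), by positivity, by positivity, aR, haR, ?_⟩
  intro i c Rr H hM hN hT α₀ hα₀ hMα hKpl KB hKB T A Q C ξ Λ hC hξ hΛ hΛξ hTS hQT hA hdA hS2 hα₁a hα₁ϱ hα4' hsmall hc₃ hsm hU ν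
  -- thresholds
  have hM₄ : M₄ ≤ ((ℓ : ℝ) + 1) * (toKT i).Mh := (le_max_left _ _).trans hM
  have hMD : MD ≤ ((ℓ : ℝ) + 1) * (toKT i).Mh := ((le_max_left _ _).trans (le_max_right _ _)).trans hM
  have hM₁' : M₁ ≤ ((ℓ : ℝ) + 1) * i.Mh := ((le_max_right _ _).trans (le_max_right _ _)).trans hM
  have hN₄ : N₄ + 1 ≤ (toKT i).R * ((ℓ + 1) * (toKT i).Mh) := le_trans (Nat.succ_le_succ (le_max_left _ _)) hN
  have hND : ND + 1 ≤ (toKT i).R * ((ℓ + 1) * (toKT i).Mh) := le_trans (Nat.succ_le_succ ((le_max_left _ _).trans (le_max_right _ _))) hN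
  have hN1 : N1 d ℓ (9 / 5000 * ρ₀) + 1 ≤ (toKT i).R * ((ℓ + 1) * (toKT i).Mh) :=
    le_trans (Nat.succ_le_succ ((le_max_right _ _).trans (le_max_right _ _))) hN
  have hT₄ : T₄ ≤ RM1 i := (le_max_left _ _).trans hT
  have hTD : TD ≤ RM1 i := ((le_max_left _ _).trans (le_max_right _ _)).trans hT
  have hT1 : 4 * Real.log ((ℓ : ℝ) + 1) / (9 / 5000 * ρ₀) ≤ RM1 i := ((le_max_right _ _).trans (le_max_right _ _)).trans hT
  -- sizes
  set s : ℝ := 2 * C * Λ ^ 2 with hsdef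
  have hs0 : 0 ≤ s := by positivity
  have hs₄ : s ≤ a₄ := hα₁a.trans (min_le_left _ _)
  have hsD : s ≤ aD := hα₁a.trans ((min_le_right _ _).trans (min_le_left _ _))
  have hsκ : s ≤ 1 / (2 * (κD * c₁ + 1)) := hα₁a.trans ((min_le_right _ _).trans (min_le_right _ _))
  -- geometry
  obtain ⟨hdnn, htri, hrefl, hsym⟩ := geoCK_dist_axioms i c Rr H
  have hlen0 : ∀ a : BlkCubeY i c, 0 ≤ (geoCK i c).len a := fun a => (geoCK_len_pos i c a).le
  -- F4: law 1, compressed: `GiK(Ṽ) = GiK(1) + GiK(1)·V·GiK(Ṽ)`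
  obtain ⟨-, ⟨hlaw1, -, -⟩, -, -, -⟩ := h4 i c Rr H hM₄ hN₄ hT₄ α₀ hα₀ hMα hKpl KB hKB T A Q C ξ Λ hC hξ hΛ hΛξ hTS hQT hA hdA hS2 hs₄ hα₁ϱ hα4' hsmall hc₃ hsm hU
  have hlawL := GiK_leftLaw_of_padded b i (T := TKnitCY i c) (B := bondsOverY i (dirDomY i c)) (cutCfgS i T (kGeo i).eta A) hlaw1
  -- R1 at the cube, rate-weakened to `ρ₀`
  obtain ⟨-, -, gGDs, -⟩ := h33 i c Rr H KB hKB hM₁'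
  have h342 : HasMajorant (g := toB6 (geoCK i c) Rr H) (blkBK i c) (GiK b i (TKnitCY i c (fun _ _ => 1)) (bondsOverY i (dirDomY i c)) * DsK b i ν)
      (fun a a' => AR * (geoCK i c).len a * Real.exp (-(ρ₀ * (geoCK i c).dist a a'))) :=
    hasMajorant_mono (g := toB6 (geoCK i c) Rr H) _ (gGDs ν) fun a a' => kernel_rate_mono hdnn hρ₀E (mul_nonneg hAR.le (hlen0 a)) a a'
  -- R3 at the cube, rate-weakened to `ρ₀`
  have hGV : HasMajorant (g := toB6 (geoCK i c) Rr H) (blkBK i c)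
      (GiK b i (TKnitCY i c (fun _ _ => 1)) (bondsOverY i (dirDomY i c)) *
        VdK b i (TKnitCY i c) (bondsOverY i (dirDomY i c)) (cutCfgS i T (kGeo i).eta A))
      (fun a a' => κD * s * Real.exp (-(ρ₀ * (geoCK i c).dist a a'))) :=
    hasMajorant_mono (g := toB6 (geoCK i c) Rr H) _
      (hD i c Rr H hMD hND hTD α₀ hα₀ hMα hKpl KB hKB T A Q C ξ Λ hC hξ hΛ hΛξ hTS hQT hA hdA hS2 hsD hα₁ϱ hα4' hsmall hc₃ hsm hU) fun a a' =>
      kernel_rate_mono hdnn hρ₀D (mul_nonneg hκD hs0) a a'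
  -- (2.61) and the convention at `(ρ₀, 9∕5000)`
  have h261' : Ineq261 dB (toB6 (geoCK i c) Rr H) ρ₀ (9 / 5000) := h261 i c Rr H hN1 (9 / 5000) le_rfl (by norm_num)
  obtain ⟨hST1, -⟩ := hST_geoCK i c hρ₀ hT1 (9 / 5000) le_rfl
  -- the located smallness `κ_D·s·c₁ ≤ 1∕2`
  have hθc : κD * s * c₁ ≤ 1 / 2 := by
    have h1 : κD * s * c₁ = (κD * c₁) * s := by ring
    rw [h1]
    calc (κD * c₁) * s ≤ (κD * c₁) * (1 / (2 * (κD * c₁ + 1))) := mul_le_mul_of_nonneg_left hsκ (mul_nonneg hκD hc₁)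
      _ = (κD * c₁) / (κD * c₁ + 1) / 2 := by field_simp
      _ ≤ 1 / 2 := by
          have : (κD * c₁) / (κD * c₁ + 1) ≤ 1 := by rw [div_le_one hκc]; linarith
          linarith
  have hsmallθ : κD * s * B6.c1 dB ρ₀ (9 / 5000) < 1 := by rw [← hc₁def]; linarith
  -- r06's fixed point: (3.86) law 1 × `∇*_ν` on the right
  have key := gExt_rightEntry_of_386L (R := Rr) (H := H) (blkBK i c) dB ρ₀ (9 / 5000) (κD * s) AR Λ4 (fun a => (geoCK i c).len a) hAR.le hΛ4
    hlen0 (mul_nonneg hκD hs0) hρ₀.le (by norm_num) (by positivity) (by nlinarith) htri hrefl hsym hdnn h261' hsmallθ hST1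
    h342 hGV hlawL
  rw [conj_cdsBₗ_one]
  refine hasMajorant_mono (g := toB6 (geoCK i c) Rr H) _ key fun a a' => ?_
  have hinv2 : (1 - κD * s * B6.c1 dB ρ₀ (9 / 5000))⁻¹ ≤ 2 := by
    rw [← hc₁def]
    calc (1 - κD * s * c₁)⁻¹ ≤ (1 / 2)⁻¹ := inv_anti₀ (by norm_num) (by linarith)
      _ = 2 := by norm_num
  have hw : 0 ≤ (geoCK i c).len a * Real.exp (-((1 - 3 * (9 / 5000)) * ρ₀ * (geoCK i c).dist a a')) :=
    mul_nonneg (geoCK_len_pos i c a).le (Real.exp_nonneg _)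
  calc AR * Λ4 ^ 2 * B6.c1 dB ρ₀ (9 / 5000) * (1 - κD * s * B6.c1 dB ρ₀ (9 / 5000))⁻¹ * (geoCK i c).len a *
        Real.exp (-((1 - 3 * (9 / 5000)) * ρ₀ * (geoCK i c).dist a a'))
      = (AR * Λ4 ^ 2 * c₁) * (1 - κD * s * B6.c1 dB ρ₀ (9 / 5000))⁻¹ *
          ((geoCK i c).len a * Real.exp (-((1 - 3 * (9 / 5000)) * ρ₀ * (geoCK i c).dist a a'))) := by rw [hc₁def]; ring
    _ ≤ (AR * Λ4 ^ 2 * c₁) * 2 * ((geoCK i c).len a * Real.exp (-((1 - 3 * (9 / 5000)) * ρ₀ * (geoCK i c).dist a a'))) := by gcongr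
    _ = 2 * AR * Λ4 ^ 2 * c₁ * (geoCK i c).len a * Real.exp (-((1 - 3 * (9 / 5000)) * ρ₀ * (geoCK i c).dist a a')) := by ring

end Main

end Literature.MathematicalPhysics.QuantumFieldTheory.Balaban1983to89.B9Cor36GDirKnitRightEntryAtCutField

end
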